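import Summits.BirchSwinnertonDyer.BirchSwinnertonDyer.Theorems.Rank1ResidualX9Defs
import Literature.NumberTheory.EllipticCurves.Wuthrich2014.RankOneEngineProofs
import Literature.NumberTheory.EllipticCurves.ModularCurve
import HarnessLib

/-!
# Route `SmallImageMuTransfer` (rung K6, leaf `BSDpOnClassX9`), crux `SchneiderX9RankOne`:
# the registered stub `stub_schneider_of_orderOne` DISCHARGED MODULO Perrin-Riou 1987 +
# Gross–Zagier–Kolyvagin + modularity, and the crux reduced to `stub_orderOne`

HONEST FRAMING (cell `b2b-bsdres`, X9 prover lineage; verbatim): the cell deletes COMBINATION-SHAPED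
residual classes of the rank-≤1 BSD formula from PUBLISHED theorems only and TYPES the
construction-shaped remainder; this is not "finishing BSD".  Nothing below asserts anything about
any curve beyond what the kernel proves; class X9 stays TYPED at class level; no pair, count, mark or
tier word moves.

Helper file for the statement item `SchneiderX9RankOne` (stmt-BirchSwinnertonDyer-19631) of the
DRAFT route `Theses/SmallImageMuTransfer.lean` (cell `bsd-smallim`).  Its registered BC3 skeleton
(sha c23ac36b) reads `SchneiderX9RankOne ⇐ stub_orderOne + stub_schneider_of_orderOne`:

* `stub_orderOne` — on the rank-`1` X9 pairs, `[T¹] L_p(f, α, T) ≠ 0` for every newform `f` of the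
  curve (OPEN as a class statement; a per-pair `p`-adic computation);
* `stub_schneider_of_orderOne` — `[T¹] L_p ≠ 0` (for every newform) ⟹ Schneider's non-degeneracy
  `Reg_p ≠ 0` for every CANONICAL `p`-adic height datum.  This is Perrin-Riou's `p`-adic
  Gross–Zagier leading-term formula read backwards: the tree theorem
  `Wuthrich2014.coeff_one_padicLFunction_ne_zero_iff_schneider` (`[T¹]L_p · log_p γ =
  q · (1 − α⁻¹)² · Reg_p`, `q ∈ ℚˣ`), itself CONDITIONAL on the named facts
  `perrinRiou_rankOne_leadingTerms` (Perrin-Riou, Invent. Math. 89 (1987) Cor. 1.8) and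
  `rank_eq_analyticRank_of_analyticRank_le_one` (Gross–Zagier–Kolyvagin); one newform of the curve
  is supplied by `nonempty_modularParametrizationData` (modularity).  All three facts are conjuncts
  of the route's support item `PublishedInputsX9` (stmt-BirchSwinnertonDyer-19632) — no NEW fact
  enters (referee bsd-smallim v8 (3): "stub_schneider_of_orderOne needs NO new fact").

So: `schneider_of_orderOne_of_perrinRiou` closes `stub_schneider_of_orderOne` MODULO
`(hPR, hGZK, hmodP)` — the registered signature verbatim as conclusion — and
`schneiderX9RankOne_of_perrinRiou` composes it with `stub_orderOne` (verbatim) into the body of the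
route decl `Theses.SmallImageMuTransfer.SchneiderX9RankOne` (stated unfolded; the DRAFT route's
`Theses` module is deliberately not imported — `unfold` + this theorem gives the decl).  Good
ORDINARY reduction at `p ≥ 5` is part of `ClassX9`, so the engine's `IsOrdinaryAt W p` and `5 ≤ p`
binders are discharged by the class predicate; irreducibility and non-surjectivity are not used.

(X9 prover GEN 38, 2026-08-26; `--supports stmt-BirchSwinnertonDyer-19631 --as helper`.)
-/

-- the summit and its single problem are both named `BirchSwinnertonDyer` (registry layout D-0017)
set_option linter.dupNamespace false

set_option autoImplicit false

noncomputable section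

open scoped Classical MatrixGroups ModularForm

open CongruenceSubgroup WeierstrassCurve
open Literature.NumberTheory.EllipticCurves Literature.NumberTheory.EllipticCurves.ModularForms
  Literature.NumberTheory.EllipticCurves.Wuthrich2014

namespace Summit.BirchSwinnertonDyer.BirchSwinnertonDyer.Rank1Residual

/-- **`stub_schneider_of_orderOne` of crux `SchneiderX9RankOne`, discharged MODULO Perrin-Riou 1987
Cor. 1.8 (`hPR`), Gross–Zagier–Kolyvagin (`hGZK`) and modularity (`hmodP`).**  For an X9 pair
`(W, p)` of analytic rank `1`: if `[T¹] L_p(f, α, T) ≠ 0` for every newform `f` of `W`, then the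
cyclotomic canonical `p`-adic height pairing is non-degenerate (`SchneiderConjecture Dh` for every
canonical `Dh`).  The conclusion (from `ClassX9 W p` on) is the registered stub signature verbatim
(skeleton c23ac36b of stmt-BirchSwinnertonDyer-19631).  Proof: pick the newform of a modular
parametrisation (`hmodP`) and apply `Wuthrich2014.coeff_one_padicLFunction_ne_zero_iff_schneider`
(`[T¹]L_p · log_p γ = q (1 − α⁻¹)² Reg_p` with `q ≠ 0`, `log_p γ ≠ 0`, `1 − α⁻¹ ≠ 0`; needs
`p ≥ 5` good ordinary — both inside `ClassX9`).  CONDITIONAL on the three named facts, all conjuncts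
of the route's `PublishedInputsX9`; nothing else. [cite: PerrinRiou1987, §1.4 Cor. 1.8]
[cite: SteinWuthrich2013, §4.1 and §9] -/
theorem schneider_of_orderOne_of_perrinRiou (hPR : perrinRiou_rankOne_leadingTerms)
    (hGZK : rank_eq_analyticRank_of_analyticRank_le_one)
    (hmodP : nonempty_modularParametrizationData) :
    ∀ (W : WeierstrassCurve ℚ) [W.IsElliptic] [W.IsGloballyMinimal] (p : ℕ) [Fact p.Prime],
      ClassX9 W p → W.analyticRank = 1 →
      (∀ {N : ℕ} [NeZero N] (f : CuspForm (Gamma0 N) 2), IsNewformOf W f →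
        PowerSeries.coeff 1 (padicLFunction f (unitRoot W p : ℚ_[p])) ≠ 0) →
      ∀ Dh : WeierstrassCurve.PAdicHeightData W p, Dh.IsCanonical →
        WeierstrassCurve.SchneiderConjecture Dh := by
  intro W _ _ p _ hX9 han hcoeff Dh hDh
  obtain ⟨-, hp, hgood, hord, -, -⟩ := hX9
  haveI : NeZero (W.conductorNorm ℤ) := ⟨(W.conductorNorm_pos_holds).ne'⟩
  obtain ⟨Dm⟩ := hmodP W
  exact (coeff_one_padicLFunction_ne_zero_iff_schneider hPR hGZK W p hp ⟨hgood, hord⟩ han Dh hDh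
    Dm.f Dm.isNewformOf).mp (hcoeff Dm.f Dm.isNewformOf)

/-- **Crux `SchneiderX9RankOne` ⟸ `stub_orderOne`, modulo the same three published facts (KERNEL
composition).**  With `hPR`, `hGZK`, `hmodP` as above and `h1` = the registered `stub_orderOne`
verbatim (`[T¹] L_p(f, α, T) ≠ 0` on every rank-`1` X9 pair, every newform — OPEN as a class
statement, certified per pair; a hypothesis here, nothing asserted), the body of the route decl
`Theses.SmallImageMuTransfer.SchneiderX9RankOne` — Schneider's conjecture on the rank-`1` part of
X9 for canonical height data, the binder `hC3` of the K6 bridge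
`bsdpOnClassX9_of_katoMuTransfer` — follows.  Stated unfolded (the route file is not imported);
`unfold Theses.SmallImageMuTransfer.SchneiderX9RankOne` + this theorem yields the decl.
[cite: PerrinRiou1987, §1.4 Cor. 1.8] [cite: Schneider1985, §1] -/
theorem schneiderX9RankOne_of_perrinRiou (hPR : perrinRiou_rankOne_leadingTerms)
    (hGZK : rank_eq_analyticRank_of_analyticRank_le_one)
    (hmodP : nonempty_modularParametrizationData)
    (h1 : ∀ (W : WeierstrassCurve ℚ) [W.IsElliptic] [W.IsGloballyMinimal] (p : ℕ) [Fact p.Prime]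
      {N : ℕ} [NeZero N] (f : CuspForm (Gamma0 N) 2),
      ClassX9 W p → W.analyticRank = 1 → IsNewformOf W f →
        PowerSeries.coeff 1 (padicLFunction f (unitRoot W p : ℚ_[p])) ≠ 0) :
    ∀ (W : WeierstrassCurve ℚ) [W.IsElliptic] [W.IsGloballyMinimal] (p : ℕ) [Fact p.Prime],
      ClassX9 W p → W.analyticRank = 1 →
      ∀ Dh : WeierstrassCurve.PAdicHeightData W p, Dh.IsCanonical →
        WeierstrassCurve.SchneiderConjecture Dh :=
  fun W _ _ p _ hX9 han ↦
    schneider_of_orderOne_of_perrinRiou hPR hGZK hmodP W p hX9 han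
      (fun f hf ↦ h1 W p f hX9 han hf)

end Summit.BirchSwinnertonDyer.BirchSwinnertonDyer.Rank1Residual

end
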